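import Mathlib

/-!
# PneNP / ConvexRankGates — `ConvexGateBlind`: private edges (extraction lemma)

Helpers (`--supports stmt-PneNP-10680`) for the ROW LOWER BOUND on single CONV gates computing
CLIQUE (`ConvexRankGatesConvexGateBlindRows.lean`). Pure finite graph theory on `Sym2 (Fin m)`:
from a large set `F` of non-loop pairs each having an endpoint outside a vertex set `S`, one
extracts `g` pairs `s(uⱼ, xⱼ) ∈ F` with PRIVATE outside endpoints `uⱼ ∉ S`: the `uⱼ` are distinct
and `uⱼ ∉ s(uₗ, xₗ)` for `l ≠ j` (`private_edges_of_card_le`). Either some vertex has large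
`F`-degree (a star: its outside neighbours are private, `private_edges_of_star`) or all outside
degrees are small and a greedy choice deleting the `≤ 2D` pairs at the endpoints of each chosen
pair succeeds (`private_edges_of_degree_le`). In the counting argument the colours of the private
endpoints are determined by the rest of a colouring making all extracted pairs monochromatic.
-/

namespace Summit.PneNP.PneNP.Theorems

open Finset

/-- **Star case.** If a vertex `z` lies on at least `g + #S + 1` edges of `F` (no loops), then `g`
of its neighbours outside `S` give private edges `s(uⱼ, z) ∈ F`. [folklore] -/
theorem private_edges_of_star {m g : ℕ} (S : Finset (Fin m)) (F : Finset (Sym2 (Fin m)))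
    (hF : ∀ f ∈ F, ¬ f.IsDiag) (z : Fin m)
    (hdeg : g + S.card + 1 ≤ (F.filter fun f => z ∈ f).card) :
    ∃ u x : Fin g → Fin m, Function.Injective u ∧ (∀ j, u j ∉ S) ∧
      (∀ j, s(u j, x j) ∈ F) ∧ (∀ j l, j ≠ l → u j ≠ x l) ∧ (∀ j, u j ≠ x j) := by
  classical
  -- the other endpoints of the edges at `z`
  set Fz := F.filter fun f => z ∈ f with hFz
  have hmem : ∀ f ∈ Fz, z ∈ f := fun f hf => (Finset.mem_filter.1 hf).2
  set oth : Sym2 (Fin m) → Fin m := fun f => if h : z ∈ f then Sym2.Mem.other h else z with hoth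
  have hoth_spec : ∀ f ∈ Fz, s(z, oth f) = f := by
    intro f hf
    simp only [hoth, dif_pos (hmem f hf)]
    exact Sym2.other_spec (hmem f hf)
  have hoth_ne : ∀ f ∈ Fz, oth f ≠ z := by
    intro f hf
    simp only [hoth, dif_pos (hmem f hf)]
    exact Sym2.other_ne (hF f (Finset.mem_filter.1 hf).1) (hmem f hf)
  have hinj : Set.InjOn oth Fz := by
    intro f hf f' hf' h
    rw [← hoth_spec f hf, ← hoth_spec f' hf', h]
  set N := (Fz.image oth) \ S with hN
  have hNcard : g ≤ N.card := by
    have h1 : (Fz.image oth).card = Fz.card := Finset.card_image_of_injOn hinj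
    have h2 : N.card + S.card ≥ (Fz.image oth).card := by
      calc (Fz.image oth).card ≤ (N ∪ S).card := Finset.card_le_card (by
            intro v hv
            by_cases hvS : v ∈ S
            · exact Finset.mem_union_right _ hvS
            · exact Finset.mem_union_left _ (Finset.mem_sdiff.2 ⟨hv, hvS⟩))
        _ ≤ N.card + S.card := Finset.card_union_le _ _
    omega
  -- choose `g` of them
  obtain ⟨T, hTN, hTcard⟩ := Finset.exists_subset_card_eq hNcard
  let emb : Fin g ≃ T := (Finset.equivFinOfCardEq hTcard).symm
  refine ⟨fun j => (emb j).1, fun _ => z, ?_, ?_, ?_, ?_, ?_⟩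
  · intro j l h
    exact emb.injective (Subtype.ext h)
  · intro j
    have := hTN (emb j).2
    exact (Finset.mem_sdiff.1 this).2
  · intro j
    have hv := (Finset.mem_sdiff.1 (hTN (emb j).2)).1
    obtain ⟨f, hf, hfo⟩ := Finset.mem_image.1 hv
    show s((emb j).1, z) ∈ F
    rw [← hfo, Sym2.eq_swap, hoth_spec f hf]
    exact (Finset.mem_filter.1 hf).1
  · intro j l _
    have hv := (Finset.mem_sdiff.1 (hTN (emb j).2)).1
    obtain ⟨f, hf, hfo⟩ := Finset.mem_image.1 hv
    show (emb j).1 ≠ z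
    rw [← hfo]
    exact hoth_ne f hf
  · intro j
    have hv := (Finset.mem_sdiff.1 (hTN (emb j).2)).1
    obtain ⟨f, hf, hfo⟩ := Finset.mem_image.1 hv
    show (emb j).1 ≠ z
    rw [← hfo]
    exact hoth_ne f hf

/-- **Greedy case.** If every edge of `F` (no loops) has an endpoint outside `S`, every outside
vertex lies on at most `D` edges of `F`, and `#F > 2 D g`, then there are `g + 1` private edges:
pick any edge, delete the `≤ 2D` edges at its (outside) endpoints, and recurse. [folklore] -/
theorem private_edges_of_degree_le {m : ℕ} (S : Finset (Fin m)) (D : ℕ) :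
    ∀ (g : ℕ) (F : Finset (Sym2 (Fin m))), (∀ f ∈ F, ¬ f.IsDiag) →
      (∀ f ∈ F, ∃ v ∈ f, v ∉ S) → (∀ v, v ∉ S → (F.filter fun f => v ∈ f).card ≤ D) →
      2 * D * g < F.card →
      ∃ u x : Fin (g + 1) → Fin m, Function.Injective u ∧ (∀ j, u j ∉ S) ∧
        (∀ j, s(u j, x j) ∈ F) ∧ (∀ j l, j ≠ l → u j ≠ x l) ∧ (∀ j, u j ≠ x j) := by
  classical
  intro g
  induction g with
  | zero =>
    intro F hF hout _ hcard
    obtain ⟨f, hf⟩ : F.Nonempty := Finset.card_pos.1 (by omega)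
    obtain ⟨v, hvf, hvS⟩ := hout f hf
    refine ⟨fun _ => v, fun _ => Sym2.Mem.other hvf,
      fun j l _ => Fin.ext (by have := j.2; have := l.2; omega),
      fun _ => hvS, fun _ => ?_,
      fun j l hjl => absurd (Fin.ext (by have := j.2; have := l.2; omega)) hjl, fun _ => ?_⟩
    · rw [Sym2.other_spec hvf]
      exact hf
    · exact (Sym2.other_ne (hF f hf) hvf).symm
  | succ g ih =>
    intro F hF hout hdeg hcard
    obtain ⟨f, hf⟩ : F.Nonempty := Finset.card_pos.1 (by omega)
    obtain ⟨v, hvf, hvS⟩ := hout f hf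
    set y := Sym2.Mem.other hvf with hy
    have hfy : s(v, y) = f := Sym2.other_spec hvf
    have hvy : v ≠ y := (Sym2.other_ne (hF f hf) hvf).symm
    -- delete the edges at `v`, and at `y` if `y` is outside
    set F' := F.filter fun f' => v ∉ f' ∧ (y ∈ S ∨ y ∉ f') with hF'
    have hsub : F' ⊆ F := Finset.filter_subset _ _
    have hcard' : 2 * D * g < F'.card := by
      have hcov : F ⊆ F' ∪ ((F.filter fun f' => v ∈ f') ∪ (F.filter fun f' => y ∉ S ∧ y ∈ f')) := by
        intro f' hf'
        by_cases h1 : v ∈ f'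
        · exact Finset.mem_union_right _ (Finset.mem_union_left _ (Finset.mem_filter.2 ⟨hf', h1⟩))
        · by_cases h2 : y ∈ S ∨ y ∉ f'
          · exact Finset.mem_union_left _ (Finset.mem_filter.2 ⟨hf', h1, h2⟩)
          · push Not at h2
            exact Finset.mem_union_right _ (Finset.mem_union_right _
              (Finset.mem_filter.2 ⟨hf', h2.1, h2.2⟩))
      have hv' : (F.filter fun f' => v ∈ f').card ≤ D := hdeg v hvS
      have hy' : (F.filter fun f' => y ∉ S ∧ y ∈ f').card ≤ D := by
        by_cases hyS : y ∈ S
        · have : (F.filter fun f' => y ∉ S ∧ y ∈ f') = ∅ :=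
            Finset.filter_eq_empty_iff.2 fun f' _ h => h.1 hyS
          rw [this, Finset.card_empty]
          exact Nat.zero_le _
        · calc (F.filter fun f' => y ∉ S ∧ y ∈ f').card
              ≤ (F.filter fun f' => y ∈ f').card :=
                Finset.card_le_card (fun f' hf' => by
                  simp only [Finset.mem_filter] at hf' ⊢
                  exact ⟨hf'.1, hf'.2.2⟩)
            _ ≤ D := hdeg y hyS
      have := (Finset.card_le_card hcov).trans
        ((Finset.card_union_le _ _).trans (Nat.add_le_add_left (Finset.card_union_le _ _) _))
      have h2 : 2 * D * (g + 1) = 2 * D * g + (D + D) := by ring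
      omega
    obtain ⟨u', x', hinj', hS', hmem', hpriv', hne'⟩ := ih F' (fun f' hf' => hF f' (hsub hf'))
      (fun f' hf' => hout f' (hsub hf')) (fun w hw => (Finset.card_le_card
        (Finset.filter_subset_filter _ hsub)).trans (hdeg w hw)) hcard'
    have hmemF' : ∀ j, v ∉ s(u' j, x' j) ∧ (y ∈ S ∨ y ∉ s(u' j, x' j)) :=
      fun j => (Finset.mem_filter.1 (hmem' j)).2
    refine ⟨Fin.cons v u', Fin.cons y x', ?_, ?_, ?_, ?_, ?_⟩
    · -- injective
      intro j l h
      refine Fin.cases (motive := fun j => (Fin.cons v u' : Fin (g + 2) → Fin m) j =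
          (Fin.cons v u' : Fin (g + 2) → Fin m) l → j = l) ?_ (fun j' => ?_) j h
      · refine Fin.cases (motive := fun l => (Fin.cons v u' : Fin (g + 2) → Fin m) 0 =
            (Fin.cons v u' : Fin (g + 2) → Fin m) l → 0 = l) (fun _ => rfl) (fun l' hl => ?_) l
        simp only [Fin.cons_zero, Fin.cons_succ] at hl
        exact absurd (by rw [hl]; exact Sym2.mem_mk_left _ _) (hmemF' l').1
      · refine Fin.cases (motive := fun l => (Fin.cons v u' : Fin (g + 2) → Fin m) j'.succ =
            (Fin.cons v u' : Fin (g + 2) → Fin m) l → j'.succ = l) (fun hl => ?_) (fun l' hl => ?_) l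
        · simp only [Fin.cons_zero, Fin.cons_succ] at hl
          exact absurd (by rw [← hl]; exact Sym2.mem_mk_left _ _) (hmemF' j').1
        · simp only [Fin.cons_succ] at hl
          rw [hinj' hl]
    · intro j
      refine Fin.cases ?_ (fun j' => ?_) j
      · simpa using hvS
      · simpa using hS' j'
    · intro j
      refine Fin.cases ?_ (fun j' => ?_) j
      · simp only [Fin.cons_zero]
        rw [hfy]
        exact hf
      · simp only [Fin.cons_succ]
        exact hsub (hmem' j')
    · intro j l hjl
      refine Fin.cases (motive := fun j => j ≠ l → (Fin.cons v u' : Fin (g + 2) → Fin m) j ≠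
          (Fin.cons y x' : Fin (g + 2) → Fin m) l) ?_ (fun j' => ?_) j hjl
      · refine Fin.cases (motive := fun l => (0 : Fin (g + 2)) ≠ l →
            (Fin.cons v u' : Fin (g + 2) → Fin m) 0 ≠ (Fin.cons y x' : Fin (g + 2) → Fin m) l)
          (fun h => absurd rfl h) (fun l' _ => ?_) l
        simp only [Fin.cons_zero, Fin.cons_succ]
        intro h
        exact (hmemF' l').1 (by rw [h]; exact Sym2.mem_mk_right _ _)
      · refine Fin.cases (motive := fun l => j'.succ ≠ l →
            (Fin.cons v u' : Fin (g + 2) → Fin m) j'.succ ≠ (Fin.cons y x' : Fin (g + 2) → Fin m) l)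
          (fun _ => ?_) (fun l' h => ?_) l
        · simp only [Fin.cons_zero, Fin.cons_succ]
          intro h
          rcases (hmemF' j').2 with hyS | hy'
          · exact hS' j' (h ▸ hyS)
          · exact hy' (by rw [← h]; exact Sym2.mem_mk_left _ _)
        · simp only [Fin.cons_succ]
          exact hpriv' j' l' (fun h' => h (by rw [h']))
    · intro j
      refine Fin.cases ?_ (fun j' => ?_) j
      · simpa using hvy
      · simpa using hne' j'

/-- **Private edges.** If every edge of `F` (no loops) has an endpoint outside `S` and
`#F ≥ 2 (g + #S) g`, then there are `g` edges `s(uⱼ, xⱼ) ∈ F` with distinct outside endpoints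
`uⱼ ∉ S` such that `uⱼ ∉ s(uₗ, xₗ)` for `l ≠ j` (and `uⱼ ≠ xⱼ`). [folklore] -/
theorem private_edges_of_card_le {m g : ℕ} (S : Finset (Fin m)) (F : Finset (Sym2 (Fin m)))
    (hF : ∀ f ∈ F, ¬ f.IsDiag) (hout : ∀ f ∈ F, ∃ v ∈ f, v ∉ S)
    (hcard : 2 * (g + S.card) * g ≤ F.card) :
    ∃ u x : Fin g → Fin m, Function.Injective u ∧ (∀ j, u j ∉ S) ∧
      (∀ j, s(u j, x j) ∈ F) ∧ (∀ j l, j ≠ l → u j ≠ x l) ∧ (∀ j, u j ≠ x j) := by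
  classical
  rcases Nat.eq_zero_or_pos g with rfl | hg
  · exact ⟨Fin.elim0, Fin.elim0, fun j => j.elim0, fun j => j.elim0, fun j => j.elim0,
      fun j => j.elim0, fun j => j.elim0⟩
  by_cases hstar : ∃ z, z ∉ S ∧ g + S.card + 1 ≤ (F.filter fun f => z ∈ f).card
  · obtain ⟨z, -, hdeg⟩ := hstar
    exact private_edges_of_star S F hF z hdeg
  · push Not at hstar
    obtain ⟨g', rfl⟩ : ∃ g', g = g' + 1 := ⟨g - 1, by omega⟩
    refine private_edges_of_degree_le S (g' + 1 + S.card) g' F hF hout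
      (fun v hv => Nat.lt_succ_iff.1 (hstar v hv)) ?_
    have h1 : 1 ≤ g' + 1 + S.card := by omega
    nlinarith

end Summit.PneNP.PneNP.Theorems
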